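import Literature.RingTheory.PBasis.KunzConjectureReduction
import Literature.RingTheory.PBasis.HarperTheorem
import HarnessLib

/-!
# Kimura–Niitsuma (1980), Theorem 3.1, first half — PROOF (discharge of the named fact F-96b)

Topic: `Literature/RingTheory/PBasis`. T. Kimura, H. Niitsuma, *Regular local ring of characteristic p and
p-basis*, J. Math. Soc. Japan **32** (1980) 363–371 (held text `paper:kimura1980-regular-local-ring-characteristic-p-p-basis`,
pages read: p. 363 = p0001 (statement l. 12–17), p. 365–368 = p0003–p0006 (Lemmas 2.1–2.6), p. 369 = p0007
(proof of Thm. 3.1, l. 6–17)).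

**Theorem 3.1, first half** (p. 363): "Let `R` be a regular local ring of characteristic `p` and let `k` be the
residue field of `R`. If there is a system of representatives `A` of a `p`-basis of `k` over `k^p` such that `R` is a
finite `R^p[A]`-module, then `R` has a `p`-basis over `R^p`. More precisely, a `p`-basis of `R` over `R^p` is obtained
as the union of `{z₁, ⋯, z_r}` and `A` where `r = dim R` and `{z₁, ⋯, z_r}` is a special minimal system of generators
for the maximal ideal of `R`." — typed in the tree as the named fact
`Literature.RingTheory.PBasis.KimuraNiitsuma1980_thm_3_1` (`KimuraNiitsuma1980.lean`); this file proves it: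
`KimuraNiitsuma1980_thm_3_1_holds`.

## The printed proof and the road taken here

The printed proof (p. 369 l. 6–17) bounds `[K : K^p(A)] ≤ p^r` through Cohen's structure theorem and the `𝔪`-adic
completion (`R̂ = R̂_r = k[[X₁, …, X_r]]`) and then invokes Lemma 2.6 (p. 367), whose proof CONSTRUCTS a special minimal
system `z` (`zᵢ = xᵢ` or `uᵢ xᵢ`). Under the theorem's finiteness hypothesis a shorter road gives the conclusion for
ANY minimal system of generators `z₁, …, z_r` of `𝔪` (`r = dim R`), with the same two ingredients the paper isolates:

* GENERATION `R = R^p[A][z]` (the Nakayama step of p. 368 l. 24–26 and Lemma 2.2 p. 365): `k = k^p[Ā]` gives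
  `R = R^p[A] + 𝔪`, hence `R = R^p[A, z] + 𝔪^N` for every `N`; `𝔪^N ⊆ (z₁^p, …, z_r^p)R ⊆ 𝔪_A R` for `N` large, and
  `𝔪_A = 𝔪 ∩ R^p[A]` lies in the Jacobson radical of `R^p[A]` (Lemma 2.1: `1/x = x^{p-1}(1/x)^p`), so Nakayama over
  `R^p[A]` (where `R` is finite) gives `R = R^p[A, z]` (`adjoin_union_eq_top`);
* INDEPENDENCE over `R^p` of the reduced monomials `a^m z^n` (`a` a finite family in `A`, exponents `< p`): by
  induction on `r = dim R`, slicing by `w = z_r` — `R/wR` is regular of dimension `r - 1` with parameters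
  `z̄₁, …, z̄_{r-1}` and the same residue field (tree: `IsRegularLocalRing.quotient_span_singleton`, Matsumura 14.2);
  a relation `∑ c^p a^m z^n = 0` read modulo `w` layer by layer in the `w`-exponent forces every coefficient into
  `wR` (`coeff_mem_span_of_sum_eq_zero`), and dividing by `w^p` and iterating, Krull's intersection theorem forces
  `c = 0` (`coeff_eq_zero_of_forall_mem_span`); the base `r = 0` is the `p`-independence of `Ā` over `k^p`
  (`indep_aux`). This replaces the completion argument; the statement proved is the typed one verbatim.

Two printed by-products are proved alongside (revision 2, same seat): the ADAPTED form — for `R` finite over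
`R^p[A]`, `A ∪ {x₁, …, x_r}` is a `p`-basis over `R^p` for EVERY system `x` of `r = dim R` generators of `𝔪`
(`AbsolutePBasis.isPBasisOver_union_range`; this is what the proof of Lemma 2.6, p. 367 l. 15–18, delivers with
all units `uᵢ = 1` once finiteness is available) — and **Corollary 3.2** (p. 369): "If `R` is a regular local
ring of characteristic `p` and if `R` is a finite `R^p`-module, then `R` has a `p`-basis over `R^p`"
(`KimuraNiitsuma1980_cor_3_2`, here read off the tree's theorem `KimuraNiitsuma1982_theorem_holds` with `R' = R^p`,
which is regular, being isomorphic to `R` through the Frobenius of the domain `R`).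

No new definitions, no new named facts (D-0026): every intermediate result is a theorem of this file. Reuses
`RelativePBasis.monomial` and the counting pattern of `RelativePBasis.isPBasisOver_range` (`KunzConjectureReduction.lean`).
Not a statement of H. Hironaka's manuscript; settled 1980 mathematics. Resolution of singularities in positive
characteristic is not proved by any of this. Written by seat `res-B-lit-kn82` g4 (literature-prover, INPUTS desk
custody, F-96b).

## References
* T. Kimura, H. Niitsuma, *Regular local ring of characteristic p and p-basis*, J. Math. Soc. Japan 32 (1980)
  363–371: Thm. 3.1 p. 363, Lemmas 2.1–2.2 p. 365, Lemma 2.6 p. 367–368, proof of Thm. 3.1 p. 369. [KimuraNiitsuma1980]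
* H. Matsumura, *Commutative Ring Theory*, CUP 1986: Thm. 14.2 (regular quotients), Thm. 8.10 (Krull's intersection
  theorem), Thm. 2.2 (Nakayama). [Matsumura1987]
-/

namespace Literature.RingTheory.PBasis

universe u

open IsLocalRing Module Literature.AlgebraicGeometry.Resolution

namespace AbsolutePBasis

open RelativePBasis (monomial)

variable {p : ℕ} [hp : Fact p.Prime]

/-! ## Small generalities -/

omit hp in
/-- A ring homomorphism maps reduced monomials to reduced monomials. [folklore] -/
private theorem map_monomial {R S : Type*} [CommRing R] [CommRing S] (f : R →+* S) {s : ℕ} (b : Fin s → R)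
    (n : Fin s → Fin p) : f (monomial p b n) = monomial p (f ∘ b) n := by
  simp [monomial, map_prod, map_pow]

/-- A proper quotient of a ring of prime characteristic `p` has characteristic `p`. [folklore] -/
private theorem charP_quotient_of_ne_top {R : Type u} [CommRing R] [CharP R p] (I : Ideal R) (hI : I ≠ ⊤) :
    CharP (R ⧸ I) p :=
  CharP.quotient' p I fun x hx => by
    by_contra h
    have hndvd : ¬ p ∣ x := fun hd => h ((CharP.cast_eq_zero_iff R p x).mpr hd)
    exact hI (I.eq_top_of_isUnit_mem hx ((CharP.isUnit_natCast_iff hp.out).mpr hndvd))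

omit hp in
/-- **From `p`-th power relations to linear independence over `R^p`.** If every relation
`∑ cᵢ^p vᵢ = 0` forces `cᵢ^p = 0`, the family `v` is linearly independent over the subring
`R^p = range (frobenius R p)`. [folklore] -/
private theorem linearIndependent_frobenius_of {R : Type u} [CommRing R] [ExpChar R p] {ι : Type*} [Fintype ι]
    (v : ι → R) (h : ∀ c : ι → R, (∑ i, c i ^ p * v i) = 0 → ∀ i, c i ^ p = 0) :
    LinearIndependent (frobenius R p).range v := by
  rw [Fintype.linearIndependent_iff]
  intro g hg i
  choose c hc using fun i => RingHom.mem_range.mp (g i).2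
  have hrel : ∑ i, c i ^ p * v i = 0 := by
    rw [← hg]
    refine Finset.sum_congr rfl fun i _ => ?_
    rw [← frobenius_def, hc i]
    rfl
  have := h c hrel i
  apply Subtype.ext
  change (g i : R) = 0
  rw [← hc i, frobenius_def, this]

omit hp in
/-- **Sub-families.** If the reduced monomials of `B : Fin S → R` are linearly independent over `R'` and
`c = B ∘ σ` for an injection `σ`, then the reduced monomials of `c` are linearly independent over `R'`
(they form a sub-family: extend exponent vectors by zero). The counting argument of
`RelativePBasis.isPBasisOver_range`. [cite: KimuraNiitsuma1980, p. 363 l. 7–10] -/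
theorem linearIndependent_monomial_of_comp {R : Type u} [CommRing R] {R' : Subring R} (hp0 : 0 < p)
    {S : ℕ} {B : Fin S → R} (hli : LinearIndependent R' (monomial p B)) {s : ℕ} (c : Fin s → R)
    (σ : Fin s → Fin S) (hσ : ∀ i, B (σ i) = c i) (hσinj : Function.Injective σ) :
    LinearIndependent R' (fun n : Fin s → Fin p => ∏ i, c i ^ ((n i : ℕ))) := by
  classical
  let ext : (Fin s → Fin p) → (Fin S → Fin p) := fun n j =>
    if h : ∃ i, σ i = j then n h.choose else ⟨0, hp0⟩
  have hext_apply : ∀ (n : Fin s → Fin p) (i : Fin s), ext n (σ i) = n i := by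
    intro n i
    have h : ∃ i', σ i' = σ i := ⟨i, rfl⟩
    simp only [ext, dif_pos h]
    congr 1
    exact hσinj h.choose_spec
  have hext_inj : Function.Injective ext := by
    intro n m h
    funext i
    rw [← hext_apply n i, ← hext_apply m i, h]
  have hmono : (fun n : Fin s → Fin p => ∏ i, c i ^ ((n i : ℕ))) = monomial p B ∘ ext := by
    funext n
    simp only [Function.comp_apply, monomial]
    rw [← Finset.prod_subset (Finset.subset_univ (Finset.univ.image σ))]
    · rw [Finset.prod_image (fun i _ j _ h => hσinj h)]
      refine Finset.prod_congr rfl fun i _ => ?_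
      rw [hσ i, hext_apply]
    · intro j _ hj
      have h : ¬ ∃ i, σ i = j := fun ⟨i, hi⟩ => hj (Finset.mem_image.mpr ⟨i, Finset.mem_univ _, hi⟩)
      simp only [ext, dif_neg h, pow_zero]
  rw [hmono]
  exact hli.comp ext hext_inj

omit hp in
/-- **Concatenation.** Independence of the mixed reduced monomials `a^m z^n` (indexed by pairs of exponent
vectors) is independence of the reduced monomials of the concatenated family `(a, z)`. [folklore] -/
private theorem linearIndependent_monomial_append {R : Type u} [CommRing R] {R' : Subring R} {s t : ℕ}
    (a : Fin s → R) (z : Fin t → R)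
    (h : LinearIndependent R'
      (fun mn : (Fin s → Fin p) × (Fin t → Fin p) => monomial p a mn.1 * monomial p z mn.2)) :
    LinearIndependent R' (monomial p (Fin.append a z)) := by
  let ψ : (Fin (s + t) → Fin p) → (Fin s → Fin p) × (Fin t → Fin p) :=
    fun n => (fun i => n (Fin.castAdd t i), fun j => n (Fin.natAdd s j))
  have hψ : Function.Injective ψ := by
    intro n n' hnn
    funext i
    induction i using Fin.addCases with
    | left i => exact congr_fun (congr_arg Prod.fst hnn) i
    | right j => exact congr_fun (congr_arg Prod.snd hnn) j
  have hmono : monomial p (Fin.append a z) =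
      (fun mn : (Fin s → Fin p) × (Fin t → Fin p) => monomial p a mn.1 * monomial p z mn.2) ∘ ψ := by
    funext n
    simp only [Function.comp_apply, monomial, ψ]
    rw [Fin.prod_univ_add]
    simp only [Fin.append_left, Fin.append_right]
  rw [hmono]
  exact h.comp ψ hψ

/-! ## Minimal systems of generators in a regular local ring -/

omit hp in
/-- In a regular local ring of dimension `r`, no member of a family of `r` generators of `𝔪` lies in `𝔪²`
(such a family is a minimal system of generators, `emb dim R = dim R = r`). [cite: Matsumura1987, §14 p. 121] -/
theorem not_mem_sq_of_span_eq {R : Type u} [CommRing R] [IsRegularLocalRing R] {r : ℕ}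
    (hdim : ringKrullDim R = r) {z : Fin r → R} (hz : Ideal.span (Set.range z) = maximalIdeal R)
    (i : Fin r) : z i ∉ maximalIdeal R ^ 2 := by
  classical
  intro hi
  have hsf : (maximalIdeal R).spanFinrank = r := by
    have h := IsRegularLocalRing.spanFinrank_maximalIdeal (R := R)
    rw [hdim] at h
    exact_mod_cast h
  -- the other generators
  set S : Finset R := (Finset.univ.erase i).image z with hS
  have hSle : Ideal.span (S : Set R) ≤ maximalIdeal R := by
    rw [← hz]
    apply Ideal.span_mono
    intro x hx
    obtain ⟨j, -, rfl⟩ := Finset.mem_image.mp (Finset.mem_coe.mp hx)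
    exact ⟨j, rfl⟩
  have hle : maximalIdeal R ≤ Ideal.span (S : Set R) ⊔ maximalIdeal R • maximalIdeal R := by
    conv_lhs => rw [← hz]
    rw [Ideal.span_le]
    rintro _ ⟨j, rfl⟩
    by_cases hji : j = i
    · subst hji
      apply Submodule.mem_sup_right
      rw [Ideal.smul_eq_mul, ← pow_two]
      exact hi
    · apply Submodule.mem_sup_left
      apply Ideal.subset_span
      exact Finset.mem_coe.mpr (Finset.mem_image.mpr ⟨j, Finset.mem_erase.mpr ⟨hji, Finset.mem_univ _⟩, rfl⟩)
  have hm : maximalIdeal R ≤ Ideal.span (S : Set R) :=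
    Submodule.le_of_le_smul_of_le_jacobson_bot (IsNoetherian.noetherian _)
      (IsLocalRing.maximalIdeal_le_jacobson _) hle
  have heq : Ideal.span (S : Set R) = maximalIdeal R := le_antisymm hSle hm
  have h1 : (maximalIdeal R).spanFinrank ≤ S.card := by
    rw [← heq, ← Set.ncard_coe_finset]
    exact Submodule.spanFinrank_span_le_ncard_of_finite S.finite_toSet
  have h2 : S.card ≤ r - 1 := by
    calc S.card ≤ (Finset.univ.erase i).card := Finset.card_image_le
      _ = r - 1 := by rw [Finset.card_erase_of_mem (Finset.mem_univ i), Finset.card_univ, Fintype.card_fin]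
  have h3 : 0 < r := Fin.pos i
  omega

/-! ## The slicing step: coefficients of a relation are divisible by `w` -/

/-- **Key divisibility step.** Let `R` be a domain, `w ≠ 0`, `Φ : ι → R` a finite family such that in `R/wR`
every relation `∑ ē_k^p Φ̄_k = 0` forces `e_k ∈ wR`. Then every relation `∑_{k, j<p} d_{k,j}^p Φ_k w^j = 0` in `R`
forces all `d_{k,j} ∈ wR`: by induction on the layer `j`, the layers `i < j` contribute multiples of `w^p`, the
layers `i > j` multiples of `w^{j+1}`, so `w^{j+1} ∣ D_j w^j` with `D_j = ∑_k d_{k,j}^p Φ_k`, whence `w ∣ D_j` and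
the hypothesis applies to layer `j`. [cite: KimuraNiitsuma1980, Lemma 2.6 (proof) p. 367–368] -/
theorem coeff_mem_span_of_sum_eq_zero {R : Type u} [CommRing R] [IsDomain R] {ι : Type*} [Fintype ι]
    {w : R} (hw : w ≠ 0) (Φ : ι → R)
    (hind : ∀ e : ι → R,
      (∑ k, (Ideal.Quotient.mk (Ideal.span {w}) (e k)) ^ p *
          Ideal.Quotient.mk (Ideal.span {w}) (Φ k)) = 0 →
        ∀ k, e k ∈ Ideal.span ({w} : Set R))
    (d : ι × Fin p → R) (hrel : (∑ kj, d kj ^ p * (Φ kj.1 * w ^ ((kj.2 : ℕ)))) = 0) :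
    ∀ kj, d kj ∈ Ideal.span ({w} : Set R) := by
  classical
  have hp' : p.Prime := hp.out
  -- the layers
  set D : Fin p → R := fun j => ∑ k, d (k, j) ^ p * Φ k with hD
  have hsum : ∑ j, D j * w ^ ((j : ℕ)) = 0 := by
    rw [← hrel, Fintype.sum_prod_type_right]
    refine Finset.sum_congr rfl fun j _ => ?_
    rw [hD, Finset.sum_mul]
    refine Finset.sum_congr rfl fun k _ => ?_
    ring
  -- by strong induction on the layer
  suffices H : ∀ n : ℕ, ∀ j : Fin p, (j : ℕ) = n → ∀ k, d (k, j) ∈ Ideal.span ({w} : Set R) by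
    rintro ⟨k, j⟩
    exact H j j rfl k
  intro n
  induction n using Nat.strong_induction_on with
  | _ n ih =>
    intro j hj k
    -- every other layer is divisible by `w^{j+1}`
    have hdiv : ∀ i : Fin p, i ≠ j → w ^ ((j : ℕ) + 1) ∣ D i * w ^ ((i : ℕ)) := by
      intro i hij
      rcases lt_or_gt_of_ne hij with hlt | hgt
      · -- layer `i < j`: coefficients already in `wR`, so `D i ∈ w^p R`
        have hi : ∀ k, d (k, i) ∈ Ideal.span ({w} : Set R) :=
          ih i (by rw [← hj]; exact_mod_cast hlt) i rfl
        choose e he using fun k => Ideal.mem_span_singleton'.mp (hi k)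
        have hDi : D i = w ^ p * ∑ k, e k ^ p * Φ k := by
          rw [hD, Finset.mul_sum]
          refine Finset.sum_congr rfl fun k _ => ?_
          rw [← he k]
          ring
        rw [hDi, mul_assoc]
        apply Dvd.dvd.mul_right
        exact pow_dvd_pow w (by have := j.2; omega)
      · -- layer `i > j`
        apply Dvd.dvd.mul_left
        exact pow_dvd_pow w (by exact_mod_cast hgt)
    -- hence `w^{j+1} ∣ D j * w^j`
    have hj' : w ^ ((j : ℕ) + 1) ∣ D j * w ^ ((j : ℕ)) := by
      have : D j * w ^ ((j : ℕ)) = -∑ i ∈ Finset.univ.erase j, D i * w ^ ((i : ℕ)) := by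
        rw [eq_neg_iff_add_eq_zero,
          Finset.add_sum_erase Finset.univ (fun i : Fin p => D i * w ^ ((i : ℕ))) (Finset.mem_univ j), hsum]
      rw [this]
      exact (Finset.dvd_sum fun i hi => hdiv i (Finset.ne_of_mem_erase hi)).neg_right
    -- cancel `w^j`
    have hwj : w ∣ D j := by
      obtain ⟨x, hx⟩ := hj'
      refine ⟨x, mul_right_cancel₀ (pow_ne_zero (j : ℕ) hw) ?_⟩
      rw [hx]
      ring
    -- read layer `j` modulo `w`
    have hzero : (∑ k, (Ideal.Quotient.mk (Ideal.span {w}) (d (k, j))) ^ p *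
        Ideal.Quotient.mk (Ideal.span {w}) (Φ k)) = 0 := by
      have : Ideal.Quotient.mk (Ideal.span {w}) (D j) = 0 :=
        Ideal.Quotient.eq_zero_iff_mem.mpr (Ideal.mem_span_singleton.mpr hwj)
      rw [hD] at this
      simpa [map_sum, map_mul, map_pow] using this
    exact hind (fun k => d (k, j)) hzero k

omit hp in
/-- **Krull step.** Let `(R, 𝔪)` be a Noetherian local domain, `0 ≠ w ∈ 𝔪`, `Ψ : κ → R` a finite family such
that every relation `∑ d_k^p Ψ_k = 0` forces all `d_k ∈ wR`. Then every such relation forces `d = 0`: writing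
`d_k = w^N d'_k` and dividing the relation by `w^{pN}` shows `d_k ∈ w^N R` for every `N`, and `⋂_N w^N R = 0`
(Krull's intersection theorem). [cite: Matsumura1987, Thm. 8.10] -/
theorem coeff_eq_zero_of_forall_mem_span {R : Type u} [CommRing R] [IsDomain R] [IsNoetherianRing R]
    [IsLocalRing R] {κ : Type*} [Fintype κ] {w : R} (hw : w ∈ maximalIdeal R) (hw0 : w ≠ 0) (Ψ : κ → R)
    (hstep : ∀ d : κ → R, (∑ k, d k ^ p * Ψ k) = 0 → ∀ k, d k ∈ Ideal.span ({w} : Set R))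
    (d : κ → R) (hrel : (∑ k, d k ^ p * Ψ k) = 0) : ∀ k, d k = 0 := by
  classical
  have key : ∀ N : ℕ, ∀ d : κ → R, (∑ k, d k ^ p * Ψ k) = 0 →
      ∀ k, d k ∈ Ideal.span ({w ^ N} : Set R) := by
    intro N
    induction N with
    | zero => intro d _ k; simp
    | succ N ih =>
      intro d hd k
      choose e he using fun k => Ideal.mem_span_singleton'.mp (ih d hd k)
      -- `∑ (e_k w^N)^p Ψ_k = w^{pN} ∑ e_k^p Ψ_k = 0`
      have hrel' : (∑ k, e k ^ p * Ψ k) = 0 := by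
        have h1 : (w ^ N) ^ p * ∑ k, e k ^ p * Ψ k = 0 := by
          rw [← hd, Finset.mul_sum]
          refine Finset.sum_congr rfl fun k _ => ?_
          rw [← he k]
          ring
        exact (mul_eq_zero.mp h1).resolve_left (pow_ne_zero _ (pow_ne_zero _ hw0))
      obtain ⟨f, hf⟩ := Ideal.mem_span_singleton'.mp (hstep e hrel' k)
      rw [← he k, ← hf]
      exact Ideal.mem_span_singleton'.mpr ⟨f, by ring⟩
  intro k
  have hmem : d k ∈ ⨅ N : ℕ, (Ideal.span ({w} : Set R)) ^ N := by
    refine Ideal.mem_iInf.mpr fun N => ?_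
    rw [Ideal.span_singleton_pow]
    exact key N d hrel k
  rwa [Ideal.iInf_pow_eq_bot_of_isLocalRing _
    (fun h => (maximalIdeal.isMaximal R).ne_top
      (top_le_iff.mp (h ▸ (Ideal.span_singleton_le_iff_mem _).mpr hw))),
    Ideal.mem_bot] at hmem

/-! ## Independence of the mixed reduced monomials `a^m z^n` over `R^p` -/

/-- **Independence, by induction on `dim R`.** Let `(R, 𝔪, k)` be a regular local ring of characteristic `p` and
dimension `r`, `a : Fin s → R` a finite family whose residues are `p`-independent over `k^p` (in the residue-free
form: `∑ c_m^p a^m ∈ 𝔪 ⇒ c_m ∈ 𝔪`), and `z : Fin r → R` a family generating `𝔪`. Then the mixed reduced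
monomials `a^m z^n` (`0 ≤ mᵢ, nⱼ < p`) admit no non-trivial relation `∑ c_{m,n}^p a^m z^n = 0`. Slicing by
`w = z_r` (`R/wR` regular of dimension `r - 1`, Matsumura 14.2), the key divisibility step and the Krull step.
[cite: KimuraNiitsuma1980, Thm. 3.1 and Lemma 2.6 p. 367–369] -/
theorem indep_aux (r : ℕ) :
    ∀ (R : Type u) [CommRing R] [CharP R p] [IsRegularLocalRing R], ringKrullDim R = r →
    ∀ (s : ℕ) (a : Fin s → R),
      (∀ c : (Fin s → Fin p) → R, (∑ m, c m ^ p * monomial p a m) ∈ maximalIdeal R →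
        ∀ m, c m ∈ maximalIdeal R) →
    ∀ (z : Fin r → R), Ideal.span (Set.range z) = maximalIdeal R →
    ∀ c : (Fin s → Fin p) × (Fin r → Fin p) → R,
      (∑ mn, c mn ^ p * (monomial p a mn.1 * monomial p z mn.2)) = 0 → ∀ mn, c mn = 0 := by
  classical
  have hp' : p.Prime := hp.out
  induction r with
  | zero =>
    intro R _ _ _ hdim s a hA z _ c hc mn
    -- `dim R = 0`: `𝔪 = 0`
    have hm0 : maximalIdeal R = ⊥ := by
      have h := IsRegularLocalRing.spanFinrank_maximalIdeal (R := R)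
      rw [hdim] at h
      have h0 : (maximalIdeal R).spanFinrank = 0 := by exact_mod_cast h
      exact (Submodule.spanFinrank_eq_zero_iff_eq_bot (IsNoetherian.noetherian _)).mp h0
    have hmono1 : ∀ n : Fin 0 → Fin p, monomial p z n = 1 := fun n => by simp [monomial]
    obtain ⟨m₀, n₀⟩ := mn
    have hrel : (∑ m, c (m, n₀) ^ p * monomial p a m) ∈ maximalIdeal R := by
      have : (∑ m, c (m, n₀) ^ p * monomial p a m) = 0 := by
        rw [← hc, Fintype.sum_prod_type]
        refine Finset.sum_congr rfl fun m _ => ?_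
        rw [Fintype.sum_subsingleton _ n₀, hmono1, mul_one]
      rw [this]
      exact Ideal.zero_mem _
    have := hA _ hrel m₀
    rwa [hm0, Ideal.mem_bot] at this
  | succ r ih =>
    intro R _ _ _ hdim s a hA z hz c hc
    haveI : IsDomain R := isDomain_of_isRegularLocalRing R
    -- the last parameter
    set w : R := z (Fin.last r) with hw
    set z' : Fin r → R := fun i => z (Fin.castSucc i) with hz'def
    have hzm : ∀ i, z i ∈ maximalIdeal R := fun i => hz ▸ Ideal.subset_span ⟨i, rfl⟩
    have hwm : w ∈ maximalIdeal R := hzm _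
    have hw2 : w ∉ maximalIdeal R ^ 2 := not_mem_sq_of_span_eq hdim hz (Fin.last r)
    have hw0 : w ≠ 0 := by rintro h; rw [h] at hw2; exact hw2 (Ideal.zero_mem _)
    -- the slice `R̄ = R / wR`
    set I : Ideal R := Ideal.span {w} with hI
    have hIne : I ≠ ⊤ := fun h => (maximalIdeal.isMaximal R).ne_top
      (top_le_iff.mp (h ▸ (Ideal.span_singleton_le_iff_mem _).mpr hwm))
    haveI : Nontrivial (R ⧸ I) := Ideal.Quotient.nontrivial_iff.mpr hIne
    haveI : CharP (R ⧸ I) p := charP_quotient_of_ne_top I hIne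
    obtain ⟨hregb, hdimb⟩ := IsRegularLocalRing.quotient_span_singleton hwm hw2
    haveI := hregb
    set π : R →+* R ⧸ I := Ideal.Quotient.mk I with hπ
    haveI : IsLocalHom π := IsLocalHom.of_surjective π Ideal.Quotient.mk_surjective
    have hπw : π w = 0 := Ideal.Quotient.eq_zero_iff_mem.mpr (Ideal.mem_span_singleton_self w)
    have hmemπ : ∀ x : R, π x ∈ maximalIdeal (R ⧸ I) ↔ x ∈ maximalIdeal R := fun x => by
      simp only [IsLocalRing.mem_maximalIdeal, mem_nonunits_iff, isUnit_map_iff]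
    -- `dim R̄ = r`
    have hdim' : ringKrullDim (R ⧸ I) = r := by
      obtain ⟨n, hn⟩ := exists_nat_cast_eq_ringKrullDim (R := R ⧸ I)
      rw [hn, hdim] at hdimb
      have : ((n + 1 : ℕ) : WithBot ℕ∞) = ((r + 1 : ℕ) : WithBot ℕ∞) := by
        push_cast
        exact hdimb
      have hnr : n + 1 = r + 1 := by exact_mod_cast this
      rw [hn]
      congr 1
      exact_mod_cast Nat.succ_injective hnr
    -- the residues of `a` stay `p`-independent in `R̄`
    have hA' : ∀ c : (Fin s → Fin p) → R ⧸ I,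
        (∑ m, c m ^ p * monomial p (π ∘ a) m) ∈ maximalIdeal (R ⧸ I) →
          ∀ m, c m ∈ maximalIdeal (R ⧸ I) := by
      intro cb hcb m
      choose c hc using fun m => Ideal.Quotient.mk_surjective (I := I) (cb m)
      have hlift : π (∑ m, c m ^ p * monomial p a m) = ∑ m, cb m ^ p * monomial p (π ∘ a) m := by
        rw [map_sum]
        refine Finset.sum_congr rfl fun m _ => ?_
        rw [map_mul, map_pow, map_monomial, hc m]
      have h1 : (∑ m, c m ^ p * monomial p a m) ∈ maximalIdeal R := by
        rw [← hmemπ, hlift]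
        exact hcb
      have := hA c h1 m
      rw [← hc m]
      exact (hmemπ _).mpr this
    -- `z̄'` generates the maximal ideal of `R̄`
    have hz'bar : Ideal.span (Set.range (π ∘ z')) = maximalIdeal (R ⧸ I) := by
      rw [← IsLocalRing.map_maximalIdeal_of_surjective π Ideal.Quotient.mk_surjective, ← hz,
        Ideal.map_span, ← Set.range_comp]
      apply le_antisymm
      · apply Ideal.span_mono
        rintro _ ⟨i, rfl⟩
        exact ⟨Fin.castSucc i, rfl⟩
      · rw [Ideal.span_le]
        rintro _ ⟨i, rfl⟩
        rcases Fin.eq_castSucc_or_eq_last i with ⟨j, rfl⟩ | rfl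
        · exact Ideal.subset_span ⟨j, rfl⟩
        · change π w ∈ _
          rw [hπw]
          exact Ideal.zero_mem _
    -- induction hypothesis on the slice
    have IH := ih (R ⧸ I) hdim' s (π ∘ a) hA' (π ∘ z') hz'bar
    -- reindex the exponents of `z` as (exponents of `z'`, exponent of `w`)
    let ι := (Fin s → Fin p) × (Fin r → Fin p)
    let Φ : ι → R := fun k => monomial p a k.1 * monomial p z' k.2
    let e : ι × Fin p ≃ (Fin s → Fin p) × (Fin (r + 1) → Fin p) :=
      (Equiv.prodAssoc _ _ _).trans
        ((Equiv.prodCongr (Equiv.refl _) (Equiv.prodComm _ _)).trans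
          (Equiv.prodCongr (Equiv.refl _) (Fin.snocEquiv fun _ => Fin p)))
    have he : ∀ x : ι × Fin p, e x = (x.1.1, Fin.snoc x.1.2 x.2) := fun x => rfl
    have hmonz : ∀ (n' : Fin r → Fin p) (j : Fin p),
        monomial p z (Fin.snoc n' j) = monomial p z' n' * w ^ ((j : ℕ)) := by
      intro n' j
      simp only [monomial]
      rw [Fin.prod_univ_castSucc]
      simp only [Fin.snoc_castSucc, Fin.snoc_last]
      rfl
    -- the hypothesis of the key step, from the induction hypothesis
    have hind : ∀ e' : ι → R,
        (∑ k, (π (e' k)) ^ p * π (Φ k)) = 0 → ∀ k, e' k ∈ Ideal.span ({w} : Set R) := by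
      intro e' he' k
      have hΦ : ∀ k : ι, π (Φ k) = monomial p (π ∘ a) k.1 * monomial p (π ∘ z') k.2 := fun k => by
        simp only [Φ, map_mul, map_monomial]
      have h0 : (∑ k, (π ∘ e') k ^ p * (monomial p (π ∘ a) k.1 * monomial p (π ∘ z') k.2)) = 0 := by
        rw [← he']
        refine Finset.sum_congr rfl fun k _ => ?_
        rw [hΦ]
        rfl
      have := IH (π ∘ e') h0 k
      exact Ideal.Quotient.eq_zero_iff_mem.mp this
    -- the relation in the reindexed form
    set d : ι × Fin p → R := fun x => c (e x) with hd
    have hrel : (∑ x, d x ^ p * (Φ x.1 * w ^ ((x.2 : ℕ)))) = 0 := by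
      rw [← hc, ← Fintype.sum_equiv e (fun x => d x ^ p * (Φ x.1 * w ^ ((x.2 : ℕ))))
        (fun mn => c mn ^ p * (monomial p a mn.1 * monomial p z mn.2))]
      intro x
      simp only [hd, he, Φ]
      rw [hmonz]
      ring
    have hstep : ∀ d : ι × Fin p → R, (∑ x, d x ^ p * (Φ x.1 * w ^ ((x.2 : ℕ)))) = 0 →
        ∀ x, d x ∈ Ideal.span ({w} : Set R) :=
      fun d hd => coeff_mem_span_of_sum_eq_zero hw0 Φ hind d hd
    have hzero := coeff_eq_zero_of_forall_mem_span hwm hw0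
      (fun x : ι × Fin p => Φ x.1 * w ^ ((x.2 : ℕ))) hstep d hrel
    intro mn
    have := hzero (e.symm mn)
    rw [hd] at this
    simpa using this

/-! ## Generation: `R = R^p[A][z]` by Nakayama over `R^p[A]` -/

/-- **Generation.** Let `(R, 𝔪, k)` be a Noetherian local ring of characteristic `p`, `A ⊆ R` with
`k = k^p[Ā]`, `R` a finite `R^p[A]`-module, and `z₁, …, z_r` generators of `𝔪`. Then `R = R^p[A, z₁, …, z_r]`:
`R = R^p[A] + 𝔪` (Lemma 2.2), so `R = R^p[A, z] + 𝔪^N` for all `N`; `𝔪^N ⊆ (z₁^p, …, z_r^p) R ⊆ 𝔪_A R` for large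
`N`, where `𝔪_A = 𝔪 ∩ R^p[A]` lies in the Jacobson radical of `R^p[A]` (Lemma 2.1: `1/x = x^{p-1} (1/x)^p`);
Nakayama. [cite: KimuraNiitsuma1980, Lemmas 2.1–2.2 p. 365; p. 368 l. 24–26] -/
theorem adjoin_union_eq_top {R : Type u} [CommRing R] [CharP R p] [IsLocalRing R] [IsNoetherianRing R]
    [CharP (ResidueField R) p] (A : Set R)
    (hres : Algebra.adjoin (frobenius (ResidueField R) p).range (residue R '' A) = ⊤)
    (hfin : Module.Finite (Algebra.adjoin (frobenius R p).range A) R)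
    {r : ℕ} (z : Fin r → R) (hz : Ideal.span (Set.range z) = maximalIdeal R) :
    Algebra.adjoin (frobenius R p).range (A ∪ Set.range z) = ⊤ := by
  classical
  have hp' : p.Prime := hp.out
  set Rp : Subring R := (frobenius R p).range with hRp
  set R₀ : Subalgebra Rp R := Algebra.adjoin Rp A with hR₀
  set T : Subalgebra Rp R := Algebra.adjoin Rp (A ∪ Set.range z) with hT
  have hR₀T : R₀ ≤ T := Algebra.adjoin_mono Set.subset_union_left
  have hzT : ∀ i, z i ∈ T := fun i => Algebra.subset_adjoin (Or.inr ⟨i, rfl⟩)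
  have hzm : ∀ i, z i ∈ maximalIdeal R := fun i => hz ▸ Ideal.subset_span ⟨i, rfl⟩
  have hpowR₀ : ∀ x : R, x ^ p ∈ R₀ := fun x =>
    Subalgebra.algebraMap_mem R₀ (⟨x ^ p, ⟨x, frobenius_def ..⟩⟩ : Rp)
  -- G1: `R = R^p[A] + 𝔪`
  have G1 : ∀ x : R, ∃ t ∈ R₀, x - t ∈ maximalIdeal R := by
    intro x
    let Q : Subring (ResidueField R) := R₀.toSubring.map (residue R)
    let S : Subalgebra (frobenius (ResidueField R) p).range (ResidueField R) :=
      { toSubsemiring := Q.toSubsemiring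
        algebraMap_mem' := by
          intro c
          obtain ⟨y, hy⟩ := RingHom.mem_range.mp c.2
          obtain ⟨x₀, rfl⟩ := residue_surjective y
          change (c : ResidueField R) ∈ Q
          refine Subring.mem_map.mpr ⟨x₀ ^ p, hpowR₀ x₀, ?_⟩
          rw [map_pow, ← hy, frobenius_def] }
    have hAS : residue R '' A ⊆ S := by
      rintro _ ⟨a, ha, rfl⟩
      change residue R a ∈ Q
      exact Subring.mem_map.mpr ⟨a, Algebra.subset_adjoin ha, rfl⟩
    have hxS : residue R x ∈ S := by
      have : residue R x ∈ Algebra.adjoin (frobenius (ResidueField R) p).range (residue R '' A) := by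
        rw [hres]; trivial
      exact Algebra.adjoin_le hAS this
    obtain ⟨t, ht, htx⟩ := Subring.mem_map.mp hxS
    exact ⟨t, ht, Ideal.Quotient.eq.mp htx.symm⟩
  -- G2: `R = T + 𝔪^N` for all `N`
  have P : ∀ N : ℕ, ∀ x ∈ maximalIdeal R ^ N, ∃ t ∈ T, x - t ∈ maximalIdeal R ^ (N + 1) := by
    intro N
    induction N with
    | zero =>
      intro x _
      obtain ⟨t, ht, h⟩ := G1 x
      exact ⟨t, hR₀T ht, by simpa using h⟩
    | succ N ih =>
      intro x hx
      rw [pow_succ] at hx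
      refine Submodule.mul_induction_on hx ?_ ?_
      · intro m hm n hn
        rw [← hz, Ideal.mem_span_range_iff_exists_fun] at hn
        obtain ⟨c, rfl⟩ := hn
        have : ∀ i, ∃ t ∈ T, m * c i - t ∈ maximalIdeal R ^ (N + 1) :=
          fun i => ih _ (Ideal.mul_mem_right _ _ hm)
        choose t ht ht' using this
        refine ⟨∑ i, t i * z i, T.sum_mem fun i _ => T.mul_mem (ht i) (hzT i), ?_⟩
        have : m * ∑ i, c i * z i - ∑ i, t i * z i = ∑ i, (m * c i - t i) * z i := by
          rw [Finset.mul_sum, ← Finset.sum_sub_distrib]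
          refine Finset.sum_congr rfl fun i _ => by ring
        rw [this]
        refine Ideal.sum_mem _ fun i _ => ?_
        rw [pow_succ]
        exact Ideal.mul_mem_mul (ht' i) (hzm i)
      · rintro x y ⟨t, ht, hxt⟩ ⟨t', ht', hyt⟩
        exact ⟨t + t', T.add_mem ht ht', by convert Ideal.add_mem _ hxt hyt using 1; ring⟩
  have Q : ∀ N : ℕ, ∀ x : R, ∃ t ∈ T, x - t ∈ maximalIdeal R ^ N := by
    intro N
    induction N with
    | zero => intro x; exact ⟨0, T.zero_mem, by simp⟩
    | succ N ih =>
      intro x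
      obtain ⟨t, ht, h⟩ := ih x
      obtain ⟨t', ht', h'⟩ := P N _ h
      exact ⟨t + t', T.add_mem ht ht', by convert h' using 1; ring⟩
  -- G3: `𝔪^N ⊆ (z₁^p, …, z_r^p) R ⊆ 𝔪_A • R`
  haveI := hfin
  set J : Ideal R₀ := (maximalIdeal R).comap (algebraMap R₀ R) with hJ
  have hJjac : J ≤ (⊥ : Ideal R₀).jacobson := by
    intro x hx
    rw [Ideal.mem_jacobson_bot]
    intro y
    -- `u = x y + 1 ∈ 1 + 𝔪` is a unit of `R`, and `u⁻¹ = u^{p-1} (u⁻¹)^p ∈ R₀`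
    have hxm : (x : R) ∈ maximalIdeal R := hx
    have hu : IsUnit ((x * y + 1 : R₀) : R) := by
      have : ((x * y + 1 : R₀) : R) = 1 + (x : R) * (y : R) := by push_cast; ring
      rw [this]
      -- `1 + m` is a unit for `m ∈ 𝔪`
      by_contra h
      have hmem : 1 + (x : R) * (y : R) ∈ maximalIdeal R := (IsLocalRing.mem_maximalIdeal _).mpr h
      have h1 : (1 : R) ∈ maximalIdeal R := by
        convert Ideal.sub_mem _ hmem (Ideal.mul_mem_right (y : R) _ hxm) using 1
        ring
      exact (maximalIdeal.isMaximal R).ne_top (Ideal.eq_top_of_isUnit_mem _ h1 isUnit_one)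
    obtain ⟨u, hu'⟩ := hu
    set v : R₀ := x * y + 1 with hv
    have hinv : ((↑u⁻¹ : R) ^ p) ∈ R₀ := hpowR₀ _
    refine ⟨⟨v, ⟨(v : R) ^ (p - 1) * (↑u⁻¹ : R) ^ p, R₀.mul_mem (R₀.pow_mem v.2 _) hinv⟩, ?_, ?_⟩, rfl⟩
    · apply Subtype.ext
      change (v : R) * ((v : R) ^ (p - 1) * (↑u⁻¹ : R) ^ p) = 1
      rw [← mul_assoc, ← pow_succ', Nat.sub_add_cancel hp'.one_le, ← hu', ← mul_pow,
        Units.mul_inv, one_pow]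
    · apply Subtype.ext
      change ((v : R) ^ (p - 1) * (↑u⁻¹ : R) ^ p) * (v : R) = 1
      rw [mul_comm, ← mul_assoc, ← pow_succ', Nat.sub_add_cancel hp'.one_le, ← hu', ← mul_pow,
        Units.mul_inv, one_pow]
  obtain ⟨N, hN⟩ : ∃ N : ℕ, maximalIdeal R ^ N ≤ Ideal.span (Set.range fun i => z i ^ p) := by
    apply Ideal.exists_pow_le_of_le_radical_of_fg _ (IsNoetherian.noetherian _)
    rw [← hz, Ideal.span_le]
    rintro _ ⟨i, rfl⟩
    exact ⟨p, Ideal.subset_span ⟨i, rfl⟩⟩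
  have hNJ : ∀ x ∈ maximalIdeal R ^ N, x ∈ J • (⊤ : Submodule R₀ R) := by
    intro x hx
    obtain ⟨c, rfl⟩ := Ideal.mem_span_range_iff_exists_fun.mp (hN hx)
    refine Submodule.sum_mem _ fun i _ => ?_
    have hzi : (⟨z i ^ p, hpowR₀ (z i)⟩ : R₀) ∈ J := by
      change z i ^ p ∈ maximalIdeal R
      exact Ideal.pow_mem_of_mem _ (hzm i) _ hp'.pos
    have : c i * z i ^ p = (⟨z i ^ p, hpowR₀ (z i)⟩ : R₀) • c i := by
      rw [Subalgebra.smul_def, mul_comm]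
      rfl
    rw [this]
    exact Submodule.smul_mem_smul hzi Submodule.mem_top
  -- G4: Nakayama over `R₀`
  let TR₀ : Submodule R₀ R :=
    { carrier := T
      add_mem' := fun hx hy => T.add_mem hx hy
      zero_mem' := T.zero_mem
      smul_mem' := fun c x hx => by
        rw [Subalgebra.smul_def]
        exact T.mul_mem (hR₀T c.2) hx }
  have htop : (⊤ : Submodule R₀ R) ≤ TR₀ ⊔ J • ⊤ := by
    intro x _
    obtain ⟨t, ht, h⟩ := Q N x
    rw [Submodule.mem_sup]
    exact ⟨t, ht, x - t, hNJ _ h, by ring⟩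
  have hle : (⊤ : Submodule R₀ R) ≤ TR₀ :=
    Submodule.le_of_le_smul_of_le_jacobson_bot Module.Finite.fg_top hJjac htop
  rw [eq_top_iff]
  intro x _
  exact hle Submodule.mem_top

/-! ## From the printed hypotheses to the residue-free `p`-independence of `A` -/

/-- If `Ā` is a `p`-basis of `k` over `k^p` (with `A → Ā` injective) and `a : Fin s → R` is an injective family
in `A`, then `∑ c_m^p a^m ∈ 𝔪` forces all `c_m ∈ 𝔪` (read the relation in `k`). [cite: KimuraNiitsuma1980, Lemma 2.2 p. 365] -/
theorem residue_indep {R : Type u} [CommRing R] [IsLocalRing R] [CharP (ResidueField R) p] {A : Set R}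
    (hinj : Set.InjOn (residue R) A)
    (hpb : IsPBasisOver p (frobenius (ResidueField R) p).range (residue R '' A))
    {s : ℕ} {a : Fin s → R} (ha : Function.Injective a) (haA : ∀ i, a i ∈ A)
    (c : (Fin s → Fin p) → R) (hc : (∑ m, c m ^ p * monomial p a m) ∈ maximalIdeal R) :
    ∀ m, c m ∈ maximalIdeal R := by
  classical
  have hp' : p.Prime := hp.out
  have hinj' : Function.Injective (residue R ∘ a) :=
    fun i j h => ha (hinj (haA i) (haA j) h)
  have hli := hpb.2 s (residue R ∘ a) hinj' (fun i => ⟨a i, haA i, rfl⟩)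
  rw [Fintype.linearIndependent_iff] at hli
  have hzero : residue R (∑ m, c m ^ p * monomial p a m) = 0 :=
    (IsLocalRing.residue_eq_zero_iff _).mpr hc
  rw [map_sum] at hzero
  let g : (Fin s → Fin p) → (frobenius (ResidueField R) p).range :=
    fun m => ⟨residue R (c m) ^ p, ⟨residue R (c m), frobenius_def ..⟩⟩
  have hg : ∑ m, g m • (fun n : Fin s → Fin p => ∏ i, (residue R ∘ a) i ^ ((n i : ℕ))) m = 0 := by
    rw [← hzero]
    refine Finset.sum_congr rfl fun m _ => ?_
    rw [map_mul, map_pow, map_monomial]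
    rfl
  intro m
  have := congrArg Subtype.val (hli g hg m)
  change residue R (c m) ^ p = 0 at this
  exact (IsLocalRing.residue_eq_zero_iff _).mp (pow_eq_zero_iff hp'.ne_zero |>.mp this)

/-! ## The adapted form: any system of `dim R` generators of `𝔪` -/

/-- **Kimura–Niitsuma 1980, Thm. 3.1 with the proof of Lemma 2.6, adapted form.** Let `R` be a regular local ring
of characteristic `p` and dimension `r`, `A ⊆ R` a system of representatives of a `p`-basis of `k` over `k^p` with
`R` a finite `R^p[A]`-module, and `x₁, …, x_r` ANY `r` generators of `𝔪` (a minimal system). Then `A ∪ {x₁, …, x_r}`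
is a `p`-basis of `R` over `R^p` (the printed proof of Lemma 2.6, p. 367 l. 15–18, reaches `A ∪ {uᵢ xᵢ}` with units
`uᵢ`; under the finiteness hypothesis of Thm. 3.1 every `uᵢ = 1` works: generation `adjoin_union_eq_top`,
independence `indep_aux`). [cite: KimuraNiitsuma1980, Thm. 3.1 p. 363 with Lemma 2.6 (proof) p. 367–368] -/
theorem isPBasisOver_union_range {R : Type u} [CommRing R] [IsRegularLocalRing R] [CharP R p]
    [CharP (ResidueField R) p] {A : Set R} (hinj : Set.InjOn (residue R) A)
    (hpb : IsPBasisOver p (frobenius (ResidueField R) p).range (residue R '' A))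
    (hfin : Module.Finite (Algebra.adjoin (frobenius R p).range A) R)
    {r : ℕ} (hdim : ringKrullDim R = r) (x : Fin r → R) (hx : Ideal.span (Set.range x) = maximalIdeal R) :
    IsPBasisOver p (frobenius R p).range (A ∪ Set.range x) := by
  classical
  have hp' : p.Prime := hp.out
  refine ⟨adjoin_union_eq_top A hpb.1 hfin x hx, ?_⟩
  intro s' b hb hbΓ
  -- the members of `b` taken from `A`
  set Jb : Finset (Fin s') := Finset.univ.filter fun i => b i ∉ Set.range x with hJb
  let ε : Fin Jb.card ≃ Jb := Jb.equivFin.symm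
  let a : Fin Jb.card → R := fun k => b (ε k)
  have haA : ∀ k, a k ∈ A := by
    intro k
    have hk : ((ε k : Fin s')) ∈ Jb := (ε k).2
    have hk' : b (ε k) ∉ Set.range x := (Finset.mem_filter.mp hk).2
    exact (hbΓ (ε k)).resolve_right hk'
  have ha : Function.Injective a := by
    intro k k' h
    exact ε.injective (Subtype.ext (hb h))
  have hA := residue_indep hinj hpb ha haA
  have hmixed := indep_aux (p := p) r R hdim Jb.card a hA x hx
  haveI : IsDomain R := isDomain_of_isRegularLocalRing R
  have hli : LinearIndependent (frobenius R p).range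
      (fun mn : (Fin Jb.card → Fin p) × (Fin r → Fin p) => monomial p a mn.1 * monomial p x mn.2) := by
    apply linearIndependent_frobenius_of
    intro c hc mn
    rw [hmixed c hc mn, zero_pow hp'.ne_zero]
  have happ := linearIndependent_monomial_append a x hli
  -- `b` is a sub-family of `(a, x)`
  let σ : Fin s' → Fin (Jb.card + r) := fun i =>
    if h : b i ∈ Set.range x then Fin.natAdd Jb.card h.choose
    else Fin.castAdd r (ε.symm ⟨i, Finset.mem_filter.mpr ⟨Finset.mem_univ _, h⟩⟩)
  have hσ : ∀ i, Fin.append a x (σ i) = b i := by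
    intro i
    by_cases h : b i ∈ Set.range x
    · simp only [σ, dif_pos h, Fin.append_right]
      exact h.choose_spec
    · simp only [σ, dif_neg h, Fin.append_left, a]
      rw [Equiv.apply_symm_apply]
  have hσinj : Function.Injective σ := by
    intro i j h
    apply hb
    rw [← hσ i, ← hσ j, h]
  exact linearIndependent_monomial_of_comp hp'.pos happ b σ hσ hσinj

end AbsolutePBasis

/-! ## The theorem -/

open AbsolutePBasis RelativePBasis in
/-- **Kimura–Niitsuma 1980, Theorem 3.1 (first half)** — discharge of the named fact
`KimuraNiitsuma1980_thm_3_1`: a regular local ring `R` of characteristic `p` which is finite over `R^p[A]`, `A` a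
system of representatives of a `p`-basis of `k` over `k^p`, has the `p`-basis `A ∪ {z₁, …, z_r}` over `R^p`,
`r = dim R`, `{z₁, …, z_r}` a minimal system of generators of `𝔪`.
[cite: KimuraNiitsuma1980, Thm. 3.1 p. 363; proof p. 369] -/
theorem KimuraNiitsuma1980_thm_3_1_holds : KimuraNiitsuma1980_thm_3_1.{u} := by
  intro p _ R _ _ _ _ A hinj hpb hfin
  classical
  -- `r = dim R` generators of `𝔪`
  obtain ⟨sgen, hcard, hspan⟩ :=
    Submodule.FG.exists_span_finset_card_eq_spanFinrank (IsNoetherian.noetherian (maximalIdeal R))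
  have hdim : ringKrullDim R = sgen.card := by
    rw [← IsRegularLocalRing.spanFinrank_maximalIdeal (R := R), ← hcard]
  let z : Fin sgen.card → R := fun i => (sgen.equivFin.symm i : R)
  have hzrange : Set.range z = (sgen : Set R) := by
    ext x
    constructor
    · rintro ⟨i, rfl⟩
      exact (sgen.equivFin.symm i).2
    · intro hx
      exact ⟨sgen.equivFin ⟨x, hx⟩, by simp [z]⟩
  have hz : Ideal.span (Set.range z) = maximalIdeal R := by
    rw [hzrange]
    exact hspan
  exact ⟨sgen.card, z, hdim, hz, isPBasisOver_union_range hinj hpb hfin hdim z hz⟩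

/-! ## Corollary 3.2 -/

/-- **Kimura–Niitsuma 1980, Corollary 3.2** (p. 369): "If `R` is a regular local ring of characteristic `p` and
if `R` is a finite `R^p`-module, then `R` has a `p`-basis over `R^p`." Read off the tree's theorem
`KimuraNiitsuma1982_theorem_holds` (Kunz's conjecture) with `R' = R^p`: `R` is a domain, so the Frobenius
`R → R^p` is a ring isomorphism and `R^p` is a regular local ring. [cite: KimuraNiitsuma1980, Cor. 3.2 p. 369] -/
theorem KimuraNiitsuma1980_cor_3_2 {p : ℕ} [Fact p.Prime] {R : Type u} [CommRing R] [IsRegularLocalRing R]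
    [CharP R p] (hfin : Module.Finite (frobenius R p).range R) :
    ∃ Γ : Set R, IsPBasisOver p (frobenius R p).range Γ := by
  haveI : IsDomain R := isDomain_of_isRegularLocalRing R
  have hinj : Function.Injective (frobenius R p).rangeRestrict := fun a b h =>
    frobenius_inj R p (congrArg Subtype.val h)
  have e : R ≃+* (frobenius R p).range :=
    RingEquiv.ofBijective (frobenius R p).rangeRestrict ⟨hinj, (frobenius R p).rangeRestrict_surjective⟩
  have hreg : IsRegularLocalRing (frobenius R p).range := IsRegularLocalRing.of_ringEquiv e
  exact KimuraNiitsuma1982_theorem_holds p R (frobenius R p).range le_rfl hreg hfin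

end Literature.RingTheory.PBasis
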